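import Literature.RingTheory.FormalGroups.FormalOModuleBudDifference
import HarnessLib

/-!
# Buds of formal `𝒪`-module laws, VIII: adding a Drinfeld cocycle to an `m`-bud gives an `m`-bud
# ([Lazard 1955] §II Lemme 2–3; [Drinfeld 1974] §1, proof of Prop. 1.4)

Topic `Literature/RingTheory/FormalGroups`; namespace `Literature.RingTheory.FormalGroups`.  One plumbing definition
(`lazardSeries m`, Lazard's `C_m(X₀,X₁)` as a power series) + fully proved theorems; no named fact, no instance, no notation, no
`sorry`.  Cell `hodgecm-mathlib`, P6 «MOD programme», sub-line P6d (power-series layer for `stub_L4B3cO`).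

* `lazardSeries m = Σ_{j ≤ m} c_{m,j} X₀^j X₁^{m−j}`; `le_order_lazardSeries`, `degCoeff_smul_lazardSeries`.
* `IsOModuleBud.add_cocycle` — if `(F, ρ)` is an `m`-bud (`m ≥ 2`) over an `𝒪`-algebra `B` and `(c, δ)` is a Drinfeld
  cocycle of degree `m` with values in `B`, then `(F + c·C_m(X₀,X₁), ρ_a + δ_a·X^m)` is an `m`-bud: the degree-`m` coefficients
  of the five variations vanish by the bud relations (★ `IsDrinfeldCocycle.isBudRelation`, ★ `coeff_assocVar`, …), so the
  variations are `≡ 0 (mod deg m+1)` and the variation lemma applies.  This is the converse half of «two buds differ by a cocycle»,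
  used to CORRECT a lift.
-/

noncomputable section

namespace Literature.RingTheory.FormalGroups

open MvPowerSeries (HasSubst subst X order coeff)
open Finset Finsupp

universe u v

variable {𝒪 : Type u} [CommRing 𝒪] {B : Type v} [CommRing B] [Algebra 𝒪 B]

/-! ## §1 Lazard's polynomial as a power series -/

variable (B) in
/-- **Lazard's `C_m(X₀,X₁)`** as a two-variable power series: `Σ_{j ≤ m} c_{m,j} · X₀^j X₁^{m−j}`. [cite: Lazard1955, §II Lemme 3] -/
def lazardSeries (m : ℕ) : MvPowerSeries (Fin 2) B :=
  ∑ j ∈ range (m + 1), MvPowerSeries.C (cocycleCoeff m j : B) * ((X 0 : MvPowerSeries (Fin 2) B) ^ j * X 1 ^ (m - j))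

/-- `C_m(X₀,X₁)` is homogeneous of degree `m`: order `≥ m`. [cite: Lazard1955, §II Lemme 3] -/
theorem le_order_lazardSeries (m : ℕ) : (m : ℕ∞) ≤ (lazardSeries B m).order := by
  refine natCast_le_order_sum _ fun j hj => natCast_le_order_mul_left _ ?_
  have hX : ∀ s : Fin 2, MvPowerSeries.constantCoeff (X s : MvPowerSeries (Fin 2) B) = 0 := fun s =>
    MvPowerSeries.constantCoeff_X s
  have h := natCast_add_le_order_mul (natCast_le_order_pow (hX 0) j) (natCast_le_order_pow (hX 1) (m - j))
  rwa [Nat.add_sub_cancel' (Finset.mem_range_succ_iff.1 hj)] at h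

/-- The degree-`m` coefficients of `c · C_m(X₀,X₁)` are `c_{m,j} · c`. [cite: Lazard1955, §II Lemme 3] -/
theorem degCoeff_smul_lazardSeries (m : ℕ) (c : B) (j : ℕ) : degCoeff m (c • lazardSeries B m) j = cocycleCoeff m j • c := by
  rcases Nat.lt_or_ge m j with hj | hj
  · rw [degCoeff_of_lt _ hj, cocycleCoeff_eq_zero_of_le hj.le, zero_smul]
  · rw [degCoeff_smul, degCoeff_of_le _ hj, lazardSeries, map_sum]
    simp_rw [MvPowerSeries.coeff_C_mul, coeff_X_pow_mul_X_pow_fin_two]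
    rw [Finset.sum_eq_single j]
    · rw [if_pos ⟨rfl, rfl⟩, nsmul_eq_mul]; ring
    · intro j' hj' hne
      rw [if_neg, mul_zero]
      rintro ⟨h1, -⟩; exact hne h1
    · intro h; exact absurd (Finset.mem_range_succ_iff.2 hj) h

/-- `δ·X^m` has order `≥ m`. [folklore] -/
private theorem le_order_smul_X_pow (δ : B) (m : ℕ) : (m : ℕ∞) ≤ MvPowerSeries.order (δ • (PowerSeries.X : PowerSeries B) ^ m) :=
  le_trans (natCast_le_order_pow (by change PowerSeries.constantCoeff PowerSeries.X = 0; simp) m) MvPowerSeries.le_order_smul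

/-- `[X^m] (δ·X^m) = δ`. [folklore] -/
private theorem coeff_smul_X_pow_self (δ : B) (m : ℕ) : PowerSeries.coeff m (δ • (PowerSeries.X : PowerSeries B) ^ m) = δ := by
  simp

/-! ## §2 Adding a cocycle -/

section AddCocycle

variable {m : ℕ} {F : MvPowerSeries (Fin 2) B} {ρ : 𝒪 → PowerSeries B}

/-- In an `𝒪`-algebra: `(a • x : B) = algebraMap a * x`, with powers. [folklore] -/
private theorem smul_eq_algebraMap_mul' (a : 𝒪) (x : B) : a • x = algebraMap 𝒪 B a * x := Algebra.smul_def a x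

/-- **Adding a Drinfeld cocycle to an `m`-bud gives an `m`-bud** (`m ≥ 2`). [cite: Lazard1955, §II Lemme 3]
[cite: Drinfeld1974, §1 Prop. 1.4 (proof)] -/
theorem IsOModuleBud.add_cocycle (hm : 2 ≤ m) (h : IsOModuleBud 𝒪 m F ρ) {c : B} {δ : 𝒪 → B}
    (hc : IsDrinfeldCocycle m c δ) :
    IsOModuleBud 𝒪 m (F + c • lazardSeries B m) (fun a => ρ a + δ a • (PowerSeries.X : PowerSeries B) ^ m) := by
  set Γ : MvPowerSeries (Fin 2) B := c • lazardSeries B m with hΓdef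
  have hΓ : (m : ℕ∞) ≤ Γ.order := le_trans (le_order_lazardSeries m) MvPowerSeries.le_order_smul
  have hθ : ∀ a, (m : ℕ∞) ≤ MvPowerSeries.order (δ a • (PowerSeries.X : PowerSeries B) ^ m) := fun a => le_order_smul_X_pow _ _
  have hγ : ∀ j, degCoeff m Γ j = cocycleCoeff m j • c := degCoeff_smul_lazardSeries m c
  have hd : ∀ a, PowerSeries.coeff m (δ a • (PowerSeries.X : PowerSeries B) ^ m) = δ a := fun a => coeff_smul_X_pow_self _ _
  have rel := hc.isBudRelation (𝒪 := 𝒪)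
  have hΓ0 : MvPowerSeries.constantCoeff Γ = 0 := by
    have := (natCast_le_order_iff.1 hΓ) 0 (by simp; omega); simpa using this
  have hθ0 : ∀ a, PowerSeries.constantCoeff (δ a • (PowerSeries.X : PowerSeries B) ^ m) = 0 := fun a => by
    simp [zero_pow (by omega : m ≠ 0)]
  -- the five variations vanish modulo degree `m + 1`
  have VA : ((m + 1 : ℕ) : ℕ∞) ≤ (assocVar Γ).order := by
    refine natCast_succ_le_order (le_order_assocVar hΓ) fun d hdeg => ?_
    have hd3 : d = single 0 (d 0) + single 1 (d 1) + single 2 (d 2) := by ext i; fin_cases i <;> simp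
    have hsum : d 0 + d 1 + d 2 = m := by
      rw [degree_eq_sum, Fin.sum_univ_three] at hdeg; exact hdeg
    rw [hd3, coeff_assocVar hΓ hsum]
    simp only [hγ]
    have hr := rel.cocycle.cocycle (d 0) (d 1) (d 2) hsum
    simp only [nsmul_eq_mul] at hr ⊢
    linear_combination -hr
  have VC : ((m + 1 : ℕ) : ℕ∞) ≤ (commDefect Γ).order := by
    refine natCast_succ_le_order (le_order_commDefect hΓ) fun d hdeg => ?_
    have hd2 : d = single 0 (d 0) + single 1 (m - d 0) ∧ d 0 ≤ m := by
      rw [degree_eq_sum, Fin.sum_univ_two] at hdeg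
      refine ⟨Finsupp.ext fun i => ?_, by omega⟩
      fin_cases i
      · simp
      · simp; omega
    rw [hd2.1, coeff_commDefect hΓ hd2.2, hγ, hγ, rel.cocycle.symm _ hd2.2, sub_self]
  have VH : ∀ a, ((m + 1 : ℕ) : ℕ∞) ≤ (homVar (algebraMap 𝒪 B a) Γ (δ a • (PowerSeries.X : PowerSeries B) ^ m)).order := by
    intro a
    refine natCast_succ_le_order (le_order_homVar hΓ (hθ a) _) fun d hdeg => ?_
    have hd2 : d = single 0 (d 0) + single 1 (m - d 0) ∧ d 0 ≤ m := by
      rw [degree_eq_sum, Fin.sum_univ_two] at hdeg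
      refine ⟨Finsupp.ext fun i => ?_, by omega⟩
      fin_cases i
      · simp
      · simp; omega
    rw [hd2.1, coeff_homVar hΓ (hθ a) _ hd2.2, hd, hγ]
    rcases Nat.eq_zero_or_pos (d 0) with h0 | h0
    · rw [h0, cocycleCoeff_zero_right, zero_smul, mul_zero, add_zero, if_pos rfl, if_neg (by omega), Nat.choose_zero_right]
      simp
    rcases hd2.2.eq_or_lt with hmm | hlt
    · rw [hmm, cocycleCoeff_eq_zero_of_le le_rfl, zero_smul, mul_zero, add_zero, if_neg (by omega), if_pos rfl,
        Nat.choose_self]; simp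
    · have hr := rel.hom a (d 0) h0 hlt
      rw [if_neg h0.ne', if_neg hlt.ne, sub_zero, sub_zero, ← nsmul_eq_mul, ← map_pow, ← map_sub, ← smul_eq_algebraMap_mul']
      exact hr
  have VAdd : ∀ a b, ((m + 1 : ℕ) : ℕ∞) ≤ MvPowerSeries.order (addVar (algebraMap 𝒪 B a) (algebraMap 𝒪 B b) Γ
      (δ a • (PowerSeries.X : PowerSeries B) ^ m) (δ b • PowerSeries.X ^ m) (δ (a + b) • PowerSeries.X ^ m)) := by
    intro a b
    refine natCast_succ_le_order (le_order_addVar hΓ (hθ a) (hθ b) (hθ (a + b)) _ _) fun d hdeg => ?_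
    have hd1 : d = single () m := by
      rw [degree_eq_sum, Fintype.sum_unique] at hdeg
      exact Finsupp.ext fun u => by obtain ⟨⟩ := u; simpa using hdeg
    rw [hd1, ← PowerSeries.coeff_def (s := single () m) (n := m) (by simp), coeff_addVar hΓ, hd, hd, hd, rel.add a b, sub_eq_zero]
    refine Finset.sum_congr rfl fun j _ => ?_
    rw [hγ, smul_eq_algebraMap_mul', map_mul, map_pow, map_pow]
  have VMul : ∀ a b, ((m + 1 : ℕ) : ℕ∞) ≤ MvPowerSeries.order (mulVar (algebraMap 𝒪 B a) (algebraMap 𝒪 B b)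
      (δ a • (PowerSeries.X : PowerSeries B) ^ m) (δ b • PowerSeries.X ^ m) (δ (a * b) • PowerSeries.X ^ m)) := by
    intro a b
    refine natCast_succ_le_order (le_order_mulVar (hθ a) (hθ b) (hθ (a * b)) _ _) fun d hdeg => ?_
    have hd1 : d = single () m := by
      rw [degree_eq_sum, Fintype.sum_unique] at hdeg
      exact Finsupp.ext fun u => by obtain ⟨⟩ := u; simpa using hdeg
    rw [hd1, ← PowerSeries.coeff_def (s := single () m) (n := m) (by simp), coeff_mulVar _ _ (hθ a), hd, hd, hd, rel.mul a b,
      ← map_pow, ← smul_eq_algebraMap_mul', ← smul_eq_algebraMap_mul', add_comm, add_sub_cancel_right, sub_self]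
  -- assemble
  refine
    { constantCoeff_F := by rw [map_add, h.constantCoeff_F, hΓ0, add_zero]
      two_le_order_F := by
        have e : F + Γ - X 0 - X 1 = (F - X 0 - X 1) + Γ := by ring
        rw [e]; exact natCast_le_order_add h.two_le_order_F (natCast_le_order_of_le hΓ hm)
      constantCoeff_ρ := fun a => by rw [map_add, h.constantCoeff_ρ, hθ0, add_zero]
      coeff_one_ρ := fun a => by
        rw [map_add, h.coeff_one_ρ, map_smul, PowerSeries.coeff_X_pow, if_neg (by omega), smul_zero, add_zero]
      assoc := ?_, comm := ?_, hom := fun a => ?_, add := fun a b => ?_, mul := fun a b => ?_, one := ?_, zero := ?_ }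
  · have V := le_order_assocDefect_add_sub h.constantCoeff_F h.two_le_order_F hm hΓ
    have e : assocDefect (F + Γ) = (assocDefect (F + Γ) - assocDefect F - assocVar Γ) + assocDefect F + assocVar Γ := by ring
    rw [e]; exact natCast_le_order_add (natCast_le_order_add V h.assoc) VA
  · rw [commDefect_add]; exact natCast_le_order_add h.comm VC
  · have V := le_order_homDefect_add_sub h.constantCoeff_F h.two_le_order_F (h.constantCoeff_ρ a) (h.two_le_order_ρ a) hm hΓ
      (hθ a)
    have e : homDefect (F + Γ) (ρ a + δ a • PowerSeries.X ^ m) =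
        (homDefect (F + Γ) (ρ a + δ a • PowerSeries.X ^ m) - homDefect F (ρ a) -
          homVar (algebraMap 𝒪 B a) Γ (δ a • PowerSeries.X ^ m)) + homDefect F (ρ a) +
          homVar (algebraMap 𝒪 B a) Γ (δ a • PowerSeries.X ^ m) := by ring
    rw [e]; exact natCast_le_order_add (natCast_le_order_add V (h.hom a)) (VH a)
  · have V := le_order_addDefect_add_sub (φab := ρ (a + b)) (θab := δ (a + b) • (PowerSeries.X : PowerSeries B) ^ m)
      h.two_le_order_F (h.constantCoeff_ρ a) (h.constantCoeff_ρ b) (h.two_le_order_ρ a) (h.two_le_order_ρ b) hm hΓ (hθ a) (hθ b)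
    set D' := addDefect (F + Γ) (ρ a + δ a • PowerSeries.X ^ m) (ρ b + δ b • PowerSeries.X ^ m)
      (ρ (a + b) + δ (a + b) • (PowerSeries.X : PowerSeries B) ^ m) with hD'
    set D := addDefect F (ρ a) (ρ b) (ρ (a + b)) with hD
    set V' := addVar (algebraMap 𝒪 B a) (algebraMap 𝒪 B b) Γ (δ a • PowerSeries.X ^ m) (δ b • PowerSeries.X ^ m)
      (δ (a + b) • (PowerSeries.X : PowerSeries B) ^ m) with hV'
    have e : D' = (D' - D - V') + D + V' := by ring
    rw [e]
    exact natCast_le_order_add (natCast_le_order_add V (h.add a b)) (VAdd a b)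
  · have V := le_order_mulDefect_add_sub (φab := ρ (a * b)) (θab := δ (a * b) • (PowerSeries.X : PowerSeries B) ^ m)
      (h.constantCoeff_ρ b) (h.two_le_order_ρ a) (h.two_le_order_ρ b) hm (hθ a) (hθ b)
    set D' := mulDefect (ρ a + δ a • (PowerSeries.X : PowerSeries B) ^ m) (ρ b + δ b • PowerSeries.X ^ m)
      (ρ (a * b) + δ (a * b) • PowerSeries.X ^ m) with hD'
    set D := mulDefect (ρ a) (ρ b) (ρ (a * b)) with hD
    set V' := mulVar (algebraMap 𝒪 B a) (algebraMap 𝒪 B b) (δ a • (PowerSeries.X : PowerSeries B) ^ m)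
      (δ b • PowerSeries.X ^ m) (δ (a * b) • PowerSeries.X ^ m) with hV'
    have e : D' = (D' - D - V') + D + V' := by ring
    rw [e]
    exact natCast_le_order_add (natCast_le_order_add V (h.mul a b)) (VMul a b)
  · simp only [hc.apply_one, zero_smul, add_zero]; exact h.one
  · simp only [hc.apply_zero, zero_smul, add_zero]; exact h.zero

end AddCocycle

end Literature.RingTheory.FormalGroups
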